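import Summits.BirchSwinnertonDyer.BirchSwinnertonDyer.Theorems.GenusKolyvaginAtTwoSupplyKernelsLossless
import Summits.BirchSwinnertonDyer.BirchSwinnertonDyer.Theorems.GenusKolyvaginAtTwoCasselsTateNumberField
import HarnessLib

/-!
# Route `GenusKolyvaginAtTwo`, residual `OffCutResidualAtTwoR` (stmt-BirchSwinnertonDyer-31767), LINE 27 «socle_selection» (bsd-idea-1 g25) —
# STUB S6U `stub_upperCountTransfer` (the K/ℚ TRANSFER of the upper count) IS A TREE THEOREM: `#Ш(E/ℚ)[2^∞] ∣ 4^(M₀) ⟹ #Ш(E/K)[2^∞] ∣ 4^(M₀)`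
# on the shallow `Δ > 0` frame — by g34's DECOUPLED sandwich, with NO archimedean compensation, NO real-nontrivial class, NO Cassels–Tate input beyond
# the tree's hyperbolicity

LEAD seat `bsd-line-gk2-p1` g24 (cell `bsd-f1-sign2`), `--supports stmt-BirchSwinnertonDyer-31767 --as helper`.  THEOREMS ONLY (no definition, no named
fact, no `sorry`).  **BSD is NOT proved by this file; `OffCutResidualAtTwoR` is NOT proved; nothing is closed.**

WHAT.  LINE 27 v1.6 (`Cruxes/OffCutResidualAtTwoR/Lines/socle_selection.lean`) has four `sorry`s: S2, S6U (`stub_upperCountTransfer`), S6L, S7.  Its S6U asks,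
on `hP`'s shallow frame (`Δ > 0`, `ord₂ C(Wd) = 0`, `#Sel₂(Wd) = 2`, `w(E) = +1`) with PRINT (`MultPublishedInputsAtTwo`), for the transfer
`#Ш(E/ℚ)[2^∞] ∣ 4^(M₀) ⟹ #Ш(E/K)[2^∞] ∣ 4^(M₀)`, and worries about an archimedean factor `2` «that squareness does NOT absorb when a = M₀».  There is
nothing to absorb: gk2-p5 g34's `Lossless.natCard_primaryComponent_sha_baseChange_two_dvd_pow_of_shaExponent` (UNCONDITIONAL, sign-free, budget
`Δ > 0 ∧ ord₂ C(Wd) = 0` allowed) gives `#Ш(E/K)[2^∞] ∣ 4^m` from ANY `ℚ`-side exponent `2^m` of `Ш(E/ℚ)[2^∞]` and `rank E(ℚ) = 0`; and the count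
`#Ш(E/ℚ)[2^∞] ∣ 4^(M₀)` IS such an exponent because `Ш(E/ℚ)[2^∞] ≃ L × L` (Cassels–Tate hyperbolicity, tree theorem
`CasselsTateNumberField.exists_addEquiv_prod_self_primaryComponent_sha`): `#L² ∣ 4^(M₀) ⟹ #L ∣ 2^(M₀) ⟹ 2^(M₀)` kills `L × L`.
* §1 `two_pow_smul_eq_zero_of_addEquiv_prod_self_of_natCard_dvd` — pure: `A ≃ L × L`, `#A ∣ 4^m` ⟹ `2^m · A = 0`.
* §2 `upperCountTransfer_of_selmerExponent` — the v1.3 form (hypothesis = the ℚ-side SHARP EXPONENT in Selmer form, which the line's S5 produces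
  anyway): `#Ш(E/K)[2^∞] ∣ 4^(M₀)` with NO print, NO Cassels–Tate item, NO real class (`rank E(ℚ) = 0` by Kummer from the exponent).
* §3 **`upperCountTransfer`** — the v1.6 signature of `stub_upperCountTransfer` VERBATIM (idle binders kept): closes S6U by name
  (`exact GenusExact.PlusDescent.SocleSelection.upperCountTransfer`).
BSD is NOT proved by any of this; the line's open stubs after this file are S2, S6L, S7.

References: [Kramer1981] Thm. 1, §2 Prop. 3; [GrossLMS1991] §5 Prop. 5.3; [McCallumLMS1991] §5 Cor. 5.6; [Cassels1962ArithmeticIV] §1;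
[Wall1963QuadraticFormsFiniteGroups] Lemma 7; [SilvermanAEC2009] Thm. X.4.2 (a).
-/

set_option autoImplicit false
-- the Theorems namespace of this sub repeats the summit name by design (D-0017 nested layout)
set_option linter.dupNamespace false

noncomputable section

open scoped Classical
open scoped AddSubgroup

namespace Summit.BirchSwinnertonDyer.BirchSwinnertonDyer.Theorems.GenusExact.PlusDescent.SocleSelection

open WeierstrassCurve NumberField IsDedekindDomain Field Literature.NumberTheory.EllipticCurves
  Literature.NumberTheory.GaloisRepresentations Literature.NumberTheory.EllipticCurves.ModularForms AddSubgroup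
open Summit.BirchSwinnertonDyer.BirchSwinnertonDyer.Theses.GenusKolyvaginAtTwo (MultPublishedInputsAtTwo CasselsTatePairingRat)
open Summit.BirchSwinnertonDyer.BirchSwinnertonDyer.Theorems.GenusSupplyNarrow

/-! ## §1 Pure: a hyperbolic group of order dividing `4^m` is killed by `2^m` -/

/-- **`A ≃ L × L` and `#A ∣ 2^(2m)` ⟹ `2^m · A = 0`.**  `#L · #L ∣ 2^m · 2^m` forces `#L ∣ 2^m`, and `#L` kills `L` (Lagrange). [folklore]
[cite: Wall1963QuadraticFormsFiniteGroups, Lemma 7] -/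
theorem two_pow_smul_eq_zero_of_addEquiv_prod_self_of_natCard_dvd {A : Type*} [AddCommGroup A] [Finite A] {L : AddSubgroup A}
    (e : A ≃+ L × L) {m : ℕ} (hA : Nat.card A ∣ 2 ^ (2 * m)) (a : A) : 2 ^ m • a = 0 := by
  haveI : Finite L := Finite.of_injective _ Subtype.val_injective
  have hcard : Nat.card A = Nat.card L * Nat.card L := by rw [Nat.card_congr e.toEquiv, Nat.card_prod]
  rw [hcard, show 2 ^ (2 * m) = 2 ^ m * 2 ^ m by rw [two_mul, pow_add]] at hA
  -- `#L ∣ 2^m`: `#L` is a power of two not exceeding `2^m`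
  have hLdvd : Nat.card L ∣ 2 ^ m * 2 ^ m := (Dvd.intro _ rfl).trans hA
  rw [← pow_add] at hLdvd
  obtain ⟨k, -, hk⟩ := (Nat.dvd_prime_pow Nat.prime_two).mp hLdvd
  have hk2 : Nat.card L ∣ 2 ^ m := by
    rw [hk] at hA ⊢
    rw [← pow_add, ← pow_add] at hA
    have hle : k + k ≤ m + m := (Nat.pow_dvd_pow_iff_le_right (by norm_num : 1 < 2)).mp hA
    exact Nat.pow_dvd_pow 2 (by omega)
  -- `#L` kills `L`, hence `2^m` kills `L × L ≃ A`
  have hkill : ∀ x : L, 2 ^ m • x = 0 := fun x ↦ by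
    obtain ⟨c, hc⟩ := hk2
    rw [hc, mul_comm, mul_nsmul]
    simp
  apply e.injective
  rw [map_nsmul, map_zero, Prod.ext_iff]
  exact ⟨by simpa using hkill (e a).1, by simpa using hkill (e a).2⟩

/-! ## §2 The transfer from the ℚ-side SHARP EXPONENT (v1.3 form) — no print, no Cassels–Tate item -/

/-- **S6U from the exponent.**  `E/ℚ` globally minimal, `C(E)` odd, `ρ_{E,2^n}` onto, `Δ_E > 0`; `K` imaginary quadratic, `d_K` odd, Heegner; frame
`(Dt, β, ι, d₁)` with `P(1)` of infinite order and `2^(M₀+1) ∤ P(1)`; `w(E) = +1`; an elliptic `Wd ≅ E^(d_K)` with `#Sel₂(Wd) = 2`, `ord₂ C(Wd) = 0`; and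
the `ℚ`-side sharp exponent in SELMER form `2^(M₀) · Sel_(2^M)(E/ℚ) = 0` (all `M`) — the output of LINE 27's S5.  Then **`#Ш(E/K)[2^∞] ∣ 2^(2·M₀)`**:
Kummer gives `rank E(ℚ) = 0` (`mordellWeilRank_eq_zero_of_two_pow_smul_selmer_eq_zero`) and the `Ш`-form exponent (`Sel_(2^k) ↠ Ш[2^k]`), and g34's
decoupled sandwich concludes.  UNCONDITIONAL; BSD is NOT proved by this. [cite: Kramer1981, Thm. 1, §2 Prop. 3] [cite: GrossLMS1991, §5 Prop. 5.3]
[cite: McCallumLMS1991, §5 Cor. 5.6] [cite: SilvermanAEC2009, Thm. X.4.2 (a)] -/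
theorem upperCountTransfer_of_selmerExponent
    (W : WeierstrassCurve ℚ) [W.IsElliptic] [W.IsGloballyMinimal] [NeZero (W.conductorNorm ℤ)]
    (hρ : ∀ n : ℕ, 0 < n → W.HasSurjectiveModNGaloisRep ((2 : ℤ) ^ n)) (hT : Odd W.tamagawaProduct) (hpos : 0 < W.Δ)
    (K : Type) [Field K] [NumberField K] (hIQ : IsImaginaryQuadratic K) (hodd : Odd (NumberField.discr K))
    (hHe : SatisfiesHeegnerHypothesis (W.conductorNorm ℤ) K)
    (Dt : ModularParametrizationData W (W.conductorNorm ℤ)) (β : ℤ) (ι : K →+* ℂ) (d₁ : KolyvaginHeegnerData Dt β ι 1)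
    (hy : ¬ IsOfFinAddOrder d₁.derivedPoint) (M₀ : ℕ)
    (hndiv : ¬ ∃ Q : (W.baseChange (ringClassField K ι 1)).toAffine.Point, ((2 ^ (M₀ + 1) : ℕ) : ℤ) • Q = d₁.derivedPoint)
    (hw : W.rootNumber = 1)
    (Wd : WeierstrassCurve ℚ) [Wd.IsElliptic] (hWd : ∃ C : VariableChange ℚ, C • W.quadraticTwist (NumberField.discr K : ℚ) = Wd)
    (hSel : Nat.card (Wd.selmerGroup 2) = 2) (hTam : padicValNat 2 Wd.tamagawaProduct = 0)
    (hsharp : ∀ (M : ℕ) (s₀ : galH1Torsion W ((2 ^ M : ℕ) : ℤ)), s₀ ∈ selmerGroup W ((2 ^ M : ℕ) : ℤ) → ((2 ^ M₀ : ℕ) : ℤ) • s₀ = 0) :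
    Nat.card (AddCommGroup.primaryComponent (W.baseChange K).sha 2) ∣ 2 ^ (2 * M₀) := by
  haveI : Fact (Nat.Prime 2) := ⟨Nat.prime_two⟩
  have hρ2 : W.HasSurjectiveModNGaloisRep 2 := by simpa using hρ 1 one_pos
  -- `rank E(ℚ) = 0` by Kummer from the Selmer-form exponent
  have hrk0 : W.mordellWeilRank = 0 := mordellWeilRank_eq_zero_of_two_pow_smul_selmer_eq_zero W (hsharp (M₀ + 1))
  -- the `Ш`-form exponent via `Sel_(2^k)(E/ℚ) ↠ Ш(E/ℚ)[2^k]`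
  have hB2Q : ∀ (k : ℕ) (a : W.galH1), a ∈ W.sha → ((2 ^ k : ℕ) : ℤ) • a = 0 → ((2 ^ M₀ : ℕ) : ℤ) • a = 0 := by
    intro k a ha hka
    rcases Nat.eq_zero_or_pos k with rfl | hkpos
    · rw [pow_zero, Nat.cast_one, one_zsmul] at hka
      rw [hka, zsmul_zero]
    · have hn : ((2 ^ k : ℕ) : ℤ) ≠ 0 := by positivity
      have hmem : a ∈ W.sha ⊓ torsionBy W.galH1 ((2 ^ k : ℕ) : ℤ) :=
        AddSubgroup.mem_inf.mpr ⟨ha, by change ((2 ^ k : ℕ) : ℤ) • a = 0; exact hka⟩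
      rw [← WeierstrassCurve.map_torsionH1ToH1_selmerGroup_holds W hn] at hmem
      obtain ⟨x, hx, rfl⟩ := AddSubgroup.mem_map.mp hmem
      rw [← map_zsmul, hsharp k x hx, map_zero]
  exact Lossless.natCard_primaryComponent_sha_baseChange_two_dvd_pow_of_shaExponent W K hT hIQ hodd hHe hρ2 Dt β ι d₁ hy M₀ hndiv hw hrk0 Wd
    hWd hSel (Or.inr ⟨hpos, hTam⟩) hB2Q

/-! ## §3 `stub_upperCountTransfer` VERBATIM (LINE 27 v1.6) -/

/-- **LINE 27 STUB S6U `stub_upperCountTransfer`, signature VERBATIM (v1.6), PROVED.**  From the COUNT `#Ш(E/ℚ)[2^∞] ∣ 4^(M₀)`: `Ш(E/ℚ)[2^∞]` is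
finite (`MultPublishedInputsAtTwo` at analytic rank `0`) and hyperbolic `≃ L × L` (Cassels–Tate over `ℚ`, tree theorem), so `2^(M₀)` kills it (§1);
`rank E(ℚ) = r_an(E) = 0` (print); then g34's decoupled sandwich with the shallow budget `Δ > 0 ∧ ord₂ C(Wd) = 0`.  The binders `¬CM`, the two
non-squares, `d_K ≠ −3`, odd-Manin, `2^(M₀) ∣ P(1)`, `r_an(Wd) = 1`, `CasselsTatePairingRat` and the real-nontrivial class are IDLE (no archimedean
compensation is needed).  Closes S6U by name; BSD is NOT proved by this; `OffCutResidualAtTwoR` is NOT proved by this.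
[cite: Kramer1981, Thm. 1, §2 Prop. 3] [cite: GrossLMS1991, §5 Prop. 5.3] [cite: Cassels1962ArithmeticIV, §1] [cite: Wall1963QuadraticFormsFiniteGroups, Lemma 7] -/
theorem upperCountTransfer :
    ∀ (W : WeierstrassCurve ℚ) [W.IsElliptic] [W.IsGloballyMinimal] [NeZero (W.conductorNorm ℤ)],
      ¬ W.HasCM → W.analyticRank = 0 → (∀ n : ℕ, 0 < n → W.HasSurjectiveModNGaloisRep ((2 : ℤ) ^ n)) → Odd W.tamagawaProduct → 0 < W.Δ →
      ∀ (K : Type) [Field K] [NumberField K], IsImaginaryQuadratic K → Odd (NumberField.discr K) → NumberField.discr K ≠ -3 →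
        SatisfiesHeegnerHypothesis (W.conductorNorm ℤ) K →
        ¬ IsSquare ((NumberField.discr K : ℚ) * -|W.Δ|) → ¬ IsSquare ((NumberField.discr K : ℚ) * (-(2 * |W.Δ|))) →
      ∀ (Dt : ModularParametrizationData W (W.conductorNorm ℤ)),
        (∀ z ∈ Dt.L.lattice, ∃ w ∈ periodLattice Dt.f, z = (Dt.c : ℂ) * w) → Odd Dt.c →
      ∀ (β : ℤ) (ι : K →+* ℂ) (d₁ : KolyvaginHeegnerData Dt β ι 1), ¬ IsOfFinAddOrder d₁.derivedPoint →
      ∀ (M₀ : ℕ), (∃ Q : (W.baseChange (ringClassField K ι 1)).toAffine.Point, ((2 ^ M₀ : ℕ) : ℤ) • Q = d₁.derivedPoint) →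
        (¬ ∃ Q : (W.baseChange (ringClassField K ι 1)).toAffine.Point, ((2 ^ (M₀ + 1) : ℕ) : ℤ) • Q = d₁.derivedPoint) →
        W.rootNumber = 1 →
      ∀ (Wd : WeierstrassCurve ℚ) [Wd.IsElliptic] [Wd.IsGloballyMinimal],
        (∃ C : WeierstrassCurve.VariableChange ℚ, C • W.quadraticTwist (NumberField.discr K : ℚ) = Wd) →
        Wd.analyticRank = 1 → Nat.card (Wd.selmerGroup 2) = 2 → padicValNat 2 Wd.tamagawaProduct = 0 →
      MultPublishedInputsAtTwo → CasselsTatePairingRat →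
      (∃ c ∈ (W.kummerSelmerStructure ((2 : ℕ) : ℤ)).selmerGroup,
        Literature.NumberTheory.GaloisRepresentations.galoisCohomology.localization (W.torsionGaloisModule ((2 : ℕ) : ℤ))
          (Sum.inl Rat.infinitePlace) 1 c ≠ 0) →
      Nat.card (AddCommGroup.primaryComponent W.sha 2) ∣ 2 ^ (2 * M₀) →
      Nat.card (AddCommGroup.primaryComponent (W.baseChange K).sha 2) ∣ 2 ^ (2 * M₀) := by
  intro W _ _ _ _hcm hr0 hρ hT hpos K _ _ hIQ hodd _h3 hHe _hsq1 _hsq2 Dt _hopt _hc β ι d₁ hy M₀ _hdiv hndiv hw Wd _ _ hWd _hrd hSel hTam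
    hGZK _hCT _hreal hcount
  haveI : Fact (Nat.Prime 2) := ⟨Nat.prime_two⟩
  have hρ2 : W.HasSurjectiveModNGaloisRep 2 := by simpa using hρ 1 one_pos
  -- print: `rank E(ℚ) = r_an(E) = 0` and `Ш(E/ℚ)` finite
  have hle : W.analyticRank ≤ 1 := by rw [hr0]; exact zero_le_one
  have hrk0 : W.mordellWeilRank = 0 := by rw [(hGZK W hle).1, hr0]
  haveI : Finite W.sha := (hGZK W hle).2
  haveI : Finite (AddCommGroup.primaryComponent W.sha 2) := Finite.of_injective _ Subtype.val_injective
  -- Cassels–Tate hyperbolicity over `ℚ`: `Ш(E/ℚ)[2^∞] ≃ L × L`, so the count is an exponent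
  obtain ⟨L, ⟨eL⟩⟩ := CasselsTateNumberField.exists_addEquiv_prod_self_primaryComponent_sha W 2
  have hexp : ∀ a : AddCommGroup.primaryComponent W.sha 2, 2 ^ M₀ • a = 0 :=
    two_pow_smul_eq_zero_of_addEquiv_prod_self_of_natCard_dvd eL hcount
  have hB2Q : ∀ (k : ℕ) (a : W.galH1), a ∈ W.sha → ((2 ^ k : ℕ) : ℤ) • a = 0 → ((2 ^ M₀ : ℕ) : ℤ) • a = 0 := by
    intro k a ha hka
    have hmem : (⟨a, ha⟩ : ↥W.sha) ∈ AddCommGroup.primaryComponent (↥W.sha) 2 := by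
      refine (AddCommGroup.mem_primaryComponent).mpr ⟨k, Subtype.ext ?_⟩
      rw [AddSubgroupClass.coe_nsmul, ZeroMemClass.coe_zero, ← natCast_zsmul]
      exact hka
    have h := congrArg (fun x : AddCommGroup.primaryComponent (↥W.sha) 2 ↦ ((x : ↥W.sha) : W.galH1)) (hexp ⟨⟨a, ha⟩, hmem⟩)
    rw [natCast_zsmul]
    simpa using h
  exact Lossless.natCard_primaryComponent_sha_baseChange_two_dvd_pow_of_shaExponent W K hT hIQ hodd hHe hρ2 Dt β ι d₁ hy M₀ hndiv hw hrk0 Wd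
    hWd hSel (Or.inr ⟨hpos, hTam⟩) hB2Q


/-! ## §4 (append, same seat) LINE 28 «visible_deep_socle» STUB N5 `stub_upperCountTransfer` (the `Δ < 0` twin) VERBATIM -/

/-- **LINE 28 STUB N5 `stub_upperCountTransfer` (v1.7/v1.8 signature VERBATIM, `Δ < 0`, budget `ord₂ C(Wd) ≤ 1`), PROVED** — the same mechanism as §3
with g34's budget disjunct `Δ < 0 ∧ ord₂ C(Wd) ≤ 1`: `Ш(E/ℚ)[2^∞]` finite (`MultPublishedInputsAtTwo`) and hyperbolic `≃ L × L` (Cassels–Tate over `ℚ`), so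
the count `#Ш(E/ℚ)[2^∞] ∣ 4^(M₀)` is the exponent `2^(M₀)`; `rank E(ℚ) = 0` (print); then
`Lossless.natCard_primaryComponent_sha_baseChange_two_dvd_pow_of_shaExponent`.  The card's worry («ramified index `2` at `v ∣ d_K` together with `e = 1`
… one factor `4` that squareness does not absorb») is void: no squareness step occurs.  Idle binders as in §3.  Closes N5 by name
(`exact …SocleSelection.upperCountTransfer_negDisc`); BSD is NOT proved by this; `OffCutResidualAtTwoR` is NOT proved by this.
[cite: Kramer1981, Thm. 1, §2 Prop. 3] [cite: GrossLMS1991, §5 Prop. 5.3] [cite: Cassels1962ArithmeticIV, §1] [cite: Wall1963QuadraticFormsFiniteGroups, Lemma 7] -/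
theorem upperCountTransfer_negDisc :
    ∀ (W : WeierstrassCurve ℚ) [W.IsElliptic] [W.IsGloballyMinimal] [NeZero (W.conductorNorm ℤ)],
      ¬ W.HasCM → W.analyticRank = 0 → (∀ n : ℕ, 0 < n → W.HasSurjectiveModNGaloisRep ((2 : ℤ) ^ n)) → Odd W.tamagawaProduct → W.Δ < 0 →
      ∀ (K : Type) [Field K] [NumberField K], IsImaginaryQuadratic K → Odd (NumberField.discr K) → NumberField.discr K ≠ -3 →
        SatisfiesHeegnerHypothesis (W.conductorNorm ℤ) K →
        ¬ IsSquare ((NumberField.discr K : ℚ) * -|W.Δ|) → ¬ IsSquare ((NumberField.discr K : ℚ) * (-(2 * |W.Δ|))) →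
      ∀ (Dt : ModularParametrizationData W (W.conductorNorm ℤ)),
        (∀ z ∈ Dt.L.lattice, ∃ w ∈ periodLattice Dt.f, z = (Dt.c : ℂ) * w) → Odd Dt.c →
      ∀ (β : ℤ) (ι : K →+* ℂ) (d₁ : KolyvaginHeegnerData Dt β ι 1), ¬ IsOfFinAddOrder d₁.derivedPoint →
      ∀ (M₀ : ℕ), (∃ Q : (W.baseChange (ringClassField K ι 1)).toAffine.Point, ((2 ^ M₀ : ℕ) : ℤ) • Q = d₁.derivedPoint) →
        (¬ ∃ Q : (W.baseChange (ringClassField K ι 1)).toAffine.Point, ((2 ^ (M₀ + 1) : ℕ) : ℤ) • Q = d₁.derivedPoint) →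
        W.rootNumber = 1 →
      ∀ (Wd : WeierstrassCurve ℚ) [Wd.IsElliptic] [Wd.IsGloballyMinimal],
        (∃ C : WeierstrassCurve.VariableChange ℚ, C • W.quadraticTwist (NumberField.discr K : ℚ) = Wd) →
        Wd.analyticRank = 1 → Nat.card (Wd.selmerGroup 2) = 2 → padicValNat 2 Wd.tamagawaProduct ≤ 1 →
      MultPublishedInputsAtTwo → CasselsTatePairingRat →
      Nat.card (AddCommGroup.primaryComponent W.sha 2) ∣ 2 ^ (2 * M₀) →
      Nat.card (AddCommGroup.primaryComponent (W.baseChange K).sha 2) ∣ 2 ^ (2 * M₀) := by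
  intro W _ _ _ _hcm hr0 hρ hT hneg K _ _ hIQ hodd _h3 hHe _hsq1 _hsq2 Dt _hopt _hc β ι d₁ hy M₀ _hdiv hndiv hw Wd _ _ hWd _hrd hSel hTam
    hGZK _hCT hcount
  haveI : Fact (Nat.Prime 2) := ⟨Nat.prime_two⟩
  have hρ2 : W.HasSurjectiveModNGaloisRep 2 := by simpa using hρ 1 one_pos
  have hle : W.analyticRank ≤ 1 := by rw [hr0]; exact zero_le_one
  have hrk0 : W.mordellWeilRank = 0 := by rw [(hGZK W hle).1, hr0]
  haveI : Finite W.sha := (hGZK W hle).2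
  haveI : Finite (AddCommGroup.primaryComponent W.sha 2) := Finite.of_injective _ Subtype.val_injective
  obtain ⟨L, ⟨eL⟩⟩ := CasselsTateNumberField.exists_addEquiv_prod_self_primaryComponent_sha W 2
  have hexp : ∀ a : AddCommGroup.primaryComponent W.sha 2, 2 ^ M₀ • a = 0 :=
    two_pow_smul_eq_zero_of_addEquiv_prod_self_of_natCard_dvd eL hcount
  have hB2Q : ∀ (k : ℕ) (a : W.galH1), a ∈ W.sha → ((2 ^ k : ℕ) : ℤ) • a = 0 → ((2 ^ M₀ : ℕ) : ℤ) • a = 0 := by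
    intro k a ha hka
    have hmem : (⟨a, ha⟩ : ↥W.sha) ∈ AddCommGroup.primaryComponent (↥W.sha) 2 := by
      refine (AddCommGroup.mem_primaryComponent).mpr ⟨k, Subtype.ext ?_⟩
      rw [AddSubgroupClass.coe_nsmul, ZeroMemClass.coe_zero, ← natCast_zsmul]
      exact hka
    have h := congrArg (fun x : AddCommGroup.primaryComponent (↥W.sha) 2 ↦ ((x : ↥W.sha) : W.galH1)) (hexp ⟨⟨a, ha⟩, hmem⟩)
    rw [natCast_zsmul]
    simpa using h
  exact Lossless.natCard_primaryComponent_sha_baseChange_two_dvd_pow_of_shaExponent W K hT hIQ hodd hHe hρ2 Dt β ι d₁ hy M₀ hndiv hw hrk0 Wd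
    hWd hSel (Or.inl ⟨hneg, hTam⟩) hB2Q

end Summit.BirchSwinnertonDyer.BirchSwinnertonDyer.Theorems.GenusExact.PlusDescent.SocleSelection

end
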